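import Literature.Computability.Complexity.CodeFPFinite
import Literature.Combinatorics.SimpleGraph.TreewidthApproximation
import HarnessLib

/-!
# Typed polynomial time on codes: a kit of list operations for the treewidth and junction-tree machines

Trunk `CplxCore`, sequel of `CodeFP.lean` / `CodeFPArith.lean` / `CodeFPBudgets.lean` /
`CodeFPFinite.lean` (the algebra `CodeFP eα eβ g` of maps computed on codes by `FP` string
functions, closed under composition, pairing, tests, folds with a polynomial accumulator bound,
`map`, `filter`, `find?`, options). The polynomial-time machine of the Markov–Shi barrier
(`Literature/Barriers/QuantumAdvantage/TensorNetworkContraction*.lean`: treewidth approximation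
`ListTD.approxTD`, junction-tree evaluation `JT.dpValue`) is a functional program over lists of
naturals; this file supplies list primitives it is written in that the toolkit lacked:

* size lemmas: `length_rawE_eq_of_perm`, `length_rawE_le_of_subperm`,
  `length_rawE_le_of_nodup_subset` (a list without repetition whose items occur in another has a
  code no longer — the shape of every vertex list of the Robertson–Seymour worklist);
* `rawReverse`, `rawZip`, `rawProduct`, `rawTakeNat` (`take` by a binary count), `rawCountNat`;
* `assignOfFP` / `labelOfFP` (reading an association list: `ListTD.assignOf`, `ListTD.labelOf`);
* `findIdxFP` (`List.findIdx` with a context), `findSomeFP` (`List.findSome?` of a code-computed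
  partial map), `foldl_units_eq_iterate` (iterating a step function along a unary fuel list is a
  `foldl`, the form in which `CodeFP.foldl` applies).

## References

* S. Arora, B. Barak, *Computational Complexity: A Modern Approach*, CUP 2009, §1.3 (closure of
  polynomial time under composition and polynomially bounded loops).
-/

namespace Literature.Computability.Complexity

namespace CodeFP

open _root_.Computability Polynomial Brick Literature.Combinatorics.SimpleGraph.ListTD

variable {α β γ σ : Type} {eα : α → List Bool} {eβ : β → List Bool} {eγ : γ → List Bool} {eσ : σ → List Bool}

/-! ### Size lemmas -/

/-- The raw code of a permutation has the same length. [folklore] -/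
theorem length_rawE_eq_of_perm (eα : α → List Bool) {l₁ l₂ : List α} (h : l₁.Perm l₂) :
    (rawE eα l₁).length = (rawE eα l₂).length := by
  rw [length_rawE, length_rawE, (h.map _).sum_eq]

/-- **A sub-permutation has a code no longer**: if `l₁ <+~ l₂` then `|rawE l₁| ≤ |rawE l₂|`.
[folklore] -/
theorem length_rawE_le_of_subperm (eα : α → List Bool) {l₁ l₂ : List α} (h : l₁.Subperm l₂) :
    (rawE eα l₁).length ≤ (rawE eα l₂).length := by
  obtain ⟨l, hp, hs⟩ := h
  rw [← length_rawE_eq_of_perm eα hp]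
  exact length_rawE_le_of_sublist eα hs

/-- **A list without repetition inside another has a code no longer.** [folklore] -/
theorem length_rawE_le_of_nodup_subset (eα : α → List Bool) {l₁ l₂ : List α}
    (hnd : l₁.Nodup) (hsub : ∀ a ∈ l₁, a ∈ l₂) : (rawE eα l₁).length ≤ (rawE eα l₂).length :=
  length_rawE_le_of_subperm eα (hnd.subperm hsub)

/-! ### Reverse, zip, product, take, count -/

/-- Folding `cons` reverses. [folklore] -/
theorem foldl_cons_eq_reverse_append (l acc : List α) : l.foldl (fun b a => a :: b) acc = l.reverse ++ acc := by
  induction l generalizing acc with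
  | nil => rfl
  | cons a l ih => rw [List.foldl_cons, ih, List.reverse_cons, List.append_assoc]; rfl

/-- **Reversal** of a raw list. [cite: AroraBarak2009, §1.3] -/
theorem rawReverse (eα : α → List Bool) : CodeFP (rawE eα) (rawE eα) List.reverse := by
  have h := foldl₀ (eα := eα) (eβ := rawE eα) (step := fun a acc => a :: acc) (b₀ := []) (rawCons eα) X
    (fun l₁ l₂ => by
      rw [eval_X, foldl_cons_eq_reverse_append, List.append_nil]
      calc (rawE eα l₁.reverse).length = (rawE eα l₁).length := length_rawE_eq_of_perm eα (List.reverse_perm l₁)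
        _ ≤ (rawE eα (l₁ ++ l₂)).length := length_rawE_le_of_sublist eα (List.sublist_append_left l₁ l₂))
  exact h.congr fun l => by rw [foldl_cons_eq_reverse_append, List.append_nil]

/-- **Zipping** two raw lists into the raw list of pairs. [cite: AroraBarak2009, §1.3] -/
theorem rawZip (eα : α → List Bool) (eβ : β → List Bool) :
    CodeFP (pairE (rawE eα) (rawE eβ)) (rawE (pairE eα eβ)) (fun p => p.1.zip p.2) := by
  have hz := zipWith (σ := Unit) (eσ := unitE) (eα := eα) (eβ := eβ) (eγ := pairE eα eβ)
    (g := fun t => (t.2.1, t.2.2)) ((snd unitE (pairE eα eβ)).congr fun t => rfl)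
  exact (hz.comp ((const _ ()).pair (CodeFP.id _))).congr fun p => by
    obtain ⟨l₁, l₂⟩ := p
    show List.zipWith (fun a b => (a, b)) l₁ l₂ = l₁.zip l₂
    rfl

/-- **The product** of two raw lists (all pairs, first list major). [cite: AroraBarak2009, §1.3] -/
theorem rawProduct (eα : α → List Bool) (eβ : β → List Bool) :
    CodeFP (pairE (rawE eα) (rawE eβ)) (rawE (pairE eα eβ)) (fun p => p.1.product p.2) := by
  -- the row of a fixed first component
  have hrow : CodeFP (pairE (rawE eβ) eα) (rawE (pairE eα eβ)) (fun q => q.1.map fun b => (q.2, b)) := by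
    have hm := map (σ := α) (eσ := eα) (eα := eβ) (eβ := pairE eα eβ) (g := fun t => (t.1, t.2))
      ((CodeFP.id (pairE eα eβ)).congr fun t => rfl)
    exact (hm.comp ((snd _ _).pair (fst _ _))).congr fun q => rfl
  have hrows := map (σ := List β) (eσ := rawE eβ) (eα := eα) (eβ := rawE (pairE eα eβ))
    (g := fun q => q.1.map fun b => (q.2, b)) hrow
  refine (((flatten (pairE eα eβ)).comp hrows).comp ((snd _ _).pair (fst _ _))).congr fun p => ?_
  obtain ⟨l₁, l₂⟩ := p
  show (l₁.map fun a => l₂.map fun b => (a, b)).flatten = l₁.product l₂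
  rw [List.product, List.flatMap_def]

/-- **`take` by a binary count** (through the unary minimum with the length). [cite: AroraBarak2009, §1.3] -/
theorem rawTakeNat (eα : α → List Bool) : CodeFP (pairE natE (rawE eα)) (rawE eα) (fun p => p.2.take p.1) := by
  have hu : CodeFP (pairE natE (rawE eα)) unE (fun p => min p.1 p.2.length) :=
    unOfNatMin.comp (((ulength eα).comp (snd _ _)).pair (fst _ _))
  refine ((rawTakeUn eα).comp (hu.pair (snd _ _))).congr fun p => ?_
  obtain ⟨k, l⟩ := p
  show l.take (min k l.length) = l.take k
  rcases le_total k l.length with h | h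
  · rw [min_eq_left h]
  · rw [min_eq_right h, List.take_length, List.take_of_length_le h]

/-- **Counting the occurrences of a numeral** in a raw list of numerals. [cite: AroraBarak2009, §1.3] -/
theorem rawCountNat : CodeFP (pairE natE (rawE natE)) natE (fun p => p.2.count p.1) := by
  have hf := filter (σ := ℕ) (eσ := natE) (eα := natE) (p := fun t => t.2 == t.1)
    ((beq natE_injective).comp ((snd _ _).pair (fst _ _)))
  exact ((natLength natE).comp hf).congr fun p => by
    obtain ⟨a, l⟩ := p
    show (l.filter fun x => x == a).length = l.count a
    rw [List.count_eq_length_filter]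

/-! ### Association lists -/

/-- `assignOf` as a `find?`. [folklore] -/
theorem assignOf_eq_find? (A : List (ℕ × ℕ)) (v : ℕ) :
    assignOf A v = ((A.find? fun q => q.1 == v).map Prod.snd).getD 0 := by
  induction A with
  | nil => rfl
  | cons q A ih =>
    rw [assignOf_cons, List.find?_cons]
    by_cases h : v = q.1
    · subst h; simp
    · have hb : (q.1 == v) = false := beq_false_of_ne (Ne.symm h)
      rw [if_neg h, hb, ih]

/-- **Reading an association list** (`ListTD.assignOf`: first binding, default `0`).
[cite: AroraBarak2009, §1.3] -/
theorem assignOfFP : CodeFP (pairE (rawE (pairE natE natE)) natE) natE (fun p => assignOf p.1 p.2) := by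
  have hfind := rawFind? (σ := ℕ) (eσ := natE) (eα := pairE natE natE) (p := fun t => t.2.1 == t.1)
    ((beq natE_injective).comp ((snd _ _).fst'.pair (fst _ _)))
  have hcase := optCases (σ := Unit) (eσ := unitE) (eα := pairE natE natE) (eδ := natE)
    (k := fun _ o => (o.map Prod.snd).getD 0) (gnone := fun _ => 0) (gsome := fun t => t.2.2)
    (const _ 0) ((snd _ _).snd') (fun _ => rfl) (fun _ _ => rfl)
  refine ((hcase.comp ((const _ ()).pair (hfind.comp ((snd _ _).pair (fst _ _))))).congr fun p => ?_)
  obtain ⟨A, v⟩ := p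
  show ((A.find? fun q => q.1 == v).map Prod.snd).getD 0 = assignOf A v
  rw [assignOf_eq_find?]

/-- **The label of a vertex** (`ListTD.labelOf S lab v = assignOf (S.zip lab) v`).
[cite: AroraBarak2009, §1.3] -/
theorem labelOfFP : CodeFP (pairE (pairE (rawE natE) (rawE natE)) natE) natE (fun p => labelOf p.1.1 p.1.2 p.2) :=
  (assignOfFP.comp (((rawZip natE natE).comp (fst _ _)).pair (snd _ _))).congr fun _ => rfl

/-! ### `findIdx`, `findSome?`, iteration -/

/-- The accumulator of the `findIdx` fold: (number of rejected items so far, found?). [folklore] -/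
def findIdxStep (p : α → Bool) (acc : ℕ × Bool) (a : α) : ℕ × Bool :=
  if acc.2 then acc else if p a then (acc.1, true) else (acc.1 + 1, false)

/-- `findIdx` as a left fold. [folklore] -/
theorem foldl_findIdxStep (p : α → Bool) (l : List α) (n : ℕ) :
    l.foldl (findIdxStep p) (n, false) = (n + l.findIdx p, decide (l.findIdx p < l.length)) := by
  induction l generalizing n with
  | nil => simp
  | cons a l ih =>
    rw [List.foldl_cons]
    by_cases hpa : p a = true
    · have hstay : ∀ (l' : List α) (acc : ℕ × Bool), acc.2 = true → l'.foldl (findIdxStep p) acc = acc := by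
        intro l' acc hacc
        induction l' generalizing acc with
        | nil => rfl
        | cons b l' ih' => rw [List.foldl_cons, show findIdxStep p acc b = acc by simp [findIdxStep, hacc], ih' acc hacc]
      rw [show findIdxStep p (n, false) a = (n, true) by simp [findIdxStep, hpa], hstay l (n, true) rfl]
      simp [List.findIdx_cons, hpa]
    · rw [show findIdxStep p (n, false) a = (n + 1, false) by simp [findIdxStep, hpa], ih (n + 1)]
      simp [List.findIdx_cons, hpa, Nat.add_assoc, Nat.add_comm 1]

/-- The found flag, bounded: the accumulator's first component is at most the number of items
folded. [folklore] -/
theorem foldl_findIdxStep_fst_le (p : α → Bool) (l : List α) (n : ℕ) :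
    (l.foldl (findIdxStep p) (n, false)).1 ≤ n + l.length := by
  rw [foldl_findIdxStep]; have := List.findIdx_le_length (p := p) (xs := l); simp; omega

/-- **`List.findIdx` with a context** (the index of the first item passing the test, `|l|` if
none). [cite: AroraBarak2009, §1.3] -/
theorem findIdxFP {p : σ × α → Bool} (hp : CodeFP (pairE eσ eα) bitE p) :
    CodeFP (pairE eσ (rawE eα)) natE (fun q => q.2.findIdx fun a => p (q.1, a)) := by
  -- the step on codes
  have hacc2 : CodeFP (pairE eσ (pairE eα (pairE natE bitE))) bitE (fun t => t.2.2.2) := ((snd _ _).snd').snd'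
  have hacc1 : CodeFP (pairE eσ (pairE eα (pairE natE bitE))) natE (fun t => t.2.2.1) := ((snd _ _).snd').fst'
  have hpa : CodeFP (pairE eσ (pairE eα (pairE natE bitE))) bitE (fun t => p (t.1, t.2.1)) :=
    hp.comp ((fst _ _).pair (snd _ _).fst')
  have hstep : CodeFP (pairE eσ (pairE eα (pairE natE bitE))) (pairE natE bitE)
      (fun t => findIdxStep (fun a => p (t.1, a)) t.2.2 t.2.1) := by
    refine (hacc2.ite ((snd _ _).snd') (hpa.ite (hacc1.pair (const _ true))
      ((natAdd.comp (hacc1.pair (const _ 1))).pair (const _ false)))).congr fun t => ?_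
    simp only [findIdxStep]
  have hfold := foldl (σ := σ) (eσ := eσ) (eα := eα) (eβ := pairE natE bitE)
    (step := fun s a acc => findIdxStep (fun a => p (s, a)) acc a) (init := fun _ => ((0 : ℕ), false))
    hstep (const eσ ((0 : ℕ), false)) (2 * X + 3) (fun s l₁ l₂ => by
      have hle := foldl_findIdxStep_fst_le (fun a => p (s, a)) l₁ 0
      set acc := l₁.foldl (findIdxStep fun a => p (s, a)) (0, false) with hacc
      rw [pairE_apply, length_boolPair, eval_add, eval_mul, eval_X]
      simp only [eval_ofNat]
      have h1 : (natE acc.1).length ≤ acc.1 := length_natE_le _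
      have h2 : (bitE acc.2).length = 1 := rfl
      have h3 : l₁.length ≤ (pairE eσ (rawE eα) (s, l₁ ++ l₂)).length := by
        rw [pairE_apply, length_boolPair]
        have := length_le_length_rawE eα (l₁ ++ l₂)
        simp at this ⊢; omega
      omega)
  refine ((fst natE bitE).comp hfold).congr fun q => ?_
  obtain ⟨s, l⟩ := q
  show (l.foldl (fun acc a => findIdxStep (fun a => p (s, a)) acc a) (0, false)).1 = l.findIdx fun a => p (s, a)
  rw [show (fun acc a => findIdxStep (fun a => p (s, a)) acc a) = findIdxStep (fun a => p (s, a)) from rfl,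
    foldl_findIdxStep]
  simp

/-- `findSome?` as a left fold over options. [folklore] -/
theorem foldl_or_eq_findSome? (f : α → Option β) (l : List α) (o : Option β) :
    l.foldl (fun acc a => acc.or (f a)) o = o.or (l.findSome? f) := by
  induction l generalizing o with
  | nil => simp
  | cons a l ih =>
    rw [List.foldl_cons, ih, List.findSome?_cons]
    cases o <;> cases f a <;> simp

/-- **`List.findSome?` of a code-computed partial map, with a context.** [cite: AroraBarak2009, §1.3] -/
theorem findSomeFP {f : σ × α → Option β} (hf : CodeFP (pairE eσ eα) (optE eβ) f) :
    CodeFP (pairE eσ (rawE eα)) (optE eβ) (fun q => q.2.findSome? fun a => f (q.1, a)) := by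
  have hf' := hf
  obtain ⟨F, hF, hFf⟩ := hf'
  obtain ⟨P, hP⟩ := exists_poly_length_le_of_mem_FP hF
  -- the step: keep a found value, else try the item
  have hstep : CodeFP (pairE eσ (pairE eα (optE eβ))) (optE eβ) (fun t => t.2.2.or (f (t.1, t.2.1))) := by
    have hc := optCases (σ := σ × α) (eσ := pairE eσ eα) (eα := eβ) (eδ := optE eβ)
      (k := fun sa o => o.or (f sa)) (gnone := f) (gsome := fun t => some t.2) hf ((optSome eβ).comp (snd _ _))
      (fun _ => rfl) (fun _ _ => rfl)
    exact (hc.comp (((fst _ _).pair (snd _ _).fst').pair (snd _ _).snd')).congr fun t => rfl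
  have hfold := foldl (σ := σ) (eσ := eσ) (eα := eα) (eβ := optE eβ)
    (step := fun s a acc => acc.or (f (s, a))) (init := fun _ => none) hstep (const eσ none) (2 * P + 2)
    (fun s l₁ l₂ => by
      rw [foldl_or_eq_findSome?, Option.none_or]
      set w := pairE eσ (rawE eα) (s, l₁ ++ l₂) with hw
      rcases h : l₁.findSome? (fun a => f (s, a)) with _ | b
      · simp [optE]
      · obtain ⟨a, ha, hfa⟩ := List.exists_of_findSome?_eq_some h
        have h2 : (optE eβ (some b)).length ≤ P.eval (pairE eσ eα (s, a)).length := by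
          rw [← hfa, ← hFf]; exact hP _
        have h3 : (pairE eσ eα (s, a)).length ≤ w.length := by
          rw [hw, pairE_apply, pairE_apply, length_boolPair, length_boolPair]
          have := length_item_le_length_rawE eα (List.mem_append_left l₂ ha)
          simp only
          omega
        have := TM2Iter.eval_mono P h3
        rw [eval_add, eval_mul]
        simp only [eval_ofNat]
        omega)
  exact hfold.congr fun q => by rw [foldl_or_eq_findSome?, Option.none_or]

/-- **Iterating along a fuel list is a fold**: `(replicate n ()).foldl (fun s _ => F s) s₀ = F^[n] s₀`.
[folklore] -/
theorem foldl_units_eq_iterate (F : β → β) (n : ℕ) (s₀ : β) :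
    (List.replicate n ()).foldl (fun s _ => F s) s₀ = F^[n] s₀ := by
  induction n generalizing s₀ with
  | zero => rfl
  | succ n ih => rw [List.replicate_succ, List.foldl_cons, ih, Function.iterate_succ_apply]

/-- Any fuel list of units is a `replicate`. [folklore] -/
theorem foldl_units_eq_iterate' (F : β → β) (u : List Unit) (s₀ : β) :
    u.foldl (fun s _ => F s) s₀ = F^[u.length] s₀ := by
  rw [← foldl_units_eq_iterate F u.length s₀, eq_replicate_unit u, List.length_replicate]

end CodeFP

end Literature.Computability.Complexity
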